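import Summits.QuantumFields.BalabanUV.T4Continuum.Support.NE3EnergyRateWCovOfEndpointChart
import HarnessLib

/-!
# T⁴ programme, node NE3 — REPAIR R3: [Balaban1985RegularSpaces] THEOREM 2 READ AT THE MINIMISER PAIR, TYPED IN THE TREE'S VOCABULARY
# (`PairLandauGaugeB8`: the Landau representative `U_A^u = W·e^{Z}` of the run-A minimiser RELATIVE TO the averaged run-B minimiser `W`,
# with the (1.36)∕(1.38)∕(1.39) clauses at `j = k`), AND THE JUNCTION «covariant root `NE3EnergyRateWCov` ⇐ `PairLandauGaugeB8` ∧ (per pair) an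
# endpoint chart STARTING AT THAT `Z` on a direction set carrying (P♮) and (RES♯)» — statement-first; a hypothesis SHAPE, asserted for nothing
# except the flat datum

Cell `pub-balaban-gaps` (YM blitz, track G2, seat `ne3`, unit `pub-balaban-gaps-ne3`; writer prover-pub-balaban-gaps-ne3-g2-0, 2026-08-22), repair
**R3** of `run/shared/lean/pub/pub-balaban-gaps/ne/NE3.md` §4∕§6 (gen-0 census: «TYPE [B8] Thm 2 AT THE PAIR as a concrete-vocabulary hypothesis SHAPE
+ junction; caveat (c1) first»).  Inputs BY NAME: the covariant root `NE3EnergyWeightedCovShape.NE3EnergyRateWCov` (p338636), the slice-generic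
endpoint-chart END `NE3EnergyRateWCovOfEndpointChart.ne3EnergyRateWCov_of_endpointChart_slice` (this seat, companion module), the tree's
covariant calculus `NE3CovariantCalculus.{hsR, cD, cDstar}`, the gauge direction `BlockAveragePushDirGauge.gaugeDir`, and K0a's nested transported
block mean `NE3CovariantBlockMean.bmeanIterW` with its curved identity (‡) `framePotW L k W (gaugeDir W μ) z = μ (L^k•z) − bmeanIterW L k W μ z`
(`NE3CovariantBlockMean.framePotW_gaugeDir`).

WHAT IS PRINTED (verbatim; held text `paper:balaban1985-cmp99-regular-spaces-gauge-fixing`, journal page = PDF page + 74).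
* [Balaban1985RegularSpaces] = T. Bałaban, CMP **99** (1985) 75–102 ("B8"), Theorem 2 p. 83: «There exist constants B₁, B₂(β₀), c₁ such that
  for arbitrary U₀, U′U₀ satisfying (1.33)–(1.35) with α₀ + α₁ ≤ c₁ there exists exactly one gauge transformation u satisfying (1.29) and such
  that the conditions (1.36)–(1.39) hold for the configuration U₁ = U′^{u⁻¹}.»  (1.36) p. 82: «∣A∣ < B₁(α₀+α₁)(Lʲη)⁻¹, ∣∇^η_{U₀}A∣ < B₁(α₀+α₁)(Lʲη)⁻²,
  ‖A‖_{1,β} ≤ B₂(β₀)(α₀+α₁)(Lʲη)^{−2−β} on Ω_j» (β ≤ β₀ < 1); (1.38) p. 82: «R(U₀)D^{η*}_{U₀}A = 0»; (1.39) p. 83: «∣D^{η*}_{U₀}D^η_{U₀}A∣, ∣Δ^η_{U₀}A∣ <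
  B₁(α₀+α₁)(Lʲη)⁻³ on Ω_j»; (1.29) p. 81: «(R₀ū)ʲ(y) = 1 for y ∈ Λ_j, j = 0, 1, …, k»; p. 80: «We consider the subspace N(Q′(U₀)) = {λ : Q′(U₀)λ = 0}
  … An operator R(U₀) is defined as an orthogonal projection … onto the subspace Δ^η_{U₀}N(Q′(U₀))» and «for u(x) = e^{iλ(x)} and λ small a
  linear part of the function (1/i) log(R₀u_j)(y) is equal to (Q′_j(U₀)λ)(y)»; p. 82: «The condition (1.35) … is satisfied if V is close to Ū₀ʲ,
  more precisely if ∣V − Ū₀ʲ∣ < α₁».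
* [Balaban1985Variational] = T. Bałaban, CMP **102** (1985) 277–309 ("B11"), Theorem 1 (8)–(10) p. 279 (the minimal orbit exists, is unique, and
  is regular with η-uniform constants) — the TYPE that makes both members of the pair eligible for (1.33)∕(1.34).

THE READING (located; every identification below is OURS, stated once here and in `ne/NE3.md` §4 R3).  (R-a) The all-small-field torus: `Ω_j = T_η`
for all `j`, so `Λ_j = ∅` for `j < k`, `Λ_k = T₁^{(k)}`, every bond of `Λ_k` is interior, and the clauses are read at `j = k`, `Lᵏη = 1`; the
tree's level-`k` lattice is `ℤᵈ` with period `N·L^k` (fine lattice = unit lattice), `ξ := (L⁻¹)^k = η`.  (R-b) The pair: `U₀ := W :=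
rescale L (bavg L U_B)` (the averaged run-B minimiser read on run A's lattice, `= cavg L U_B`), `U′U₀ := U_A`; both have `k`-fold average `V`, so
(1.35) holds for every `α₁ > 0` and (1.31)'s `V′ = V(Ū₀ᵏ)⁻¹ = 1`.  (R-c) `U₁ = e^{iηA}U₀` ↦ the tree's right chart `vary W Z 1 = W·e^{Z}` with
`Z` END-framed (as in `NE3EnergyRateWCov`): `‖Z‖ = η∣A∣`, a covariant lattice difference of `Z` is `η²·∇^η A`, a second one `η^{2+β}`× the
Hölder quotient of `∇^η A` at distance `η`.  (R-d) `N(Q′(W))` ↦ the skew `(N·L^k)`-periodic site fields `μ` with `bmeanIterW L k W μ = 0`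
(K0a's nested transported block mean — the cell's reading of [Balaban1985Averaging] (78)–(80), certified against the frame potential by the
curved (‡)); `Δ^η_{U₀}` on site fields ↦ `Σ_ν cDstar W ν (cD W ν ·)` ([Balaban1985BackgroundPropagators] (3.23) «Δ^η_U = D^{η*}_U D^η_U» TYPE);
«R(U₀)X = 0» ↦ the VARIATIONAL form «X ⊥ Δ N(Q′)» (as `B8Eq127LandauGauge.IsLandauBG` does on abstract carriers), moved onto `A` by one
summation by parts: `Z ⊥ gaugeDir W (Δ_W μ)` for all `μ ∈ N(Q′(W))`.  (R-e) (1.39): the `D^{η*}_{U₀}D^η_{U₀}A` member is typed (rough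
Laplacian `covLapDir`); the `Δ^η_{U₀}A` member (Hodge form) is not.  (R-f) The Hölder clause is typed at NEAREST-NEIGHBOUR distance only
(print bounds all pairs of bonds) — exactly the second covariant difference that INTERFACE REQUEST NE7→NE3 amendment 4 calls (Lip₂′ᶜ), at
the printed level `ξ^{2+β}`; the covariant root's `ξ³` is the case `β = 1`, which [Balaban1985Variational] (9) prints («β₀ = 1») but B8
does not derive (census caveat (c2); pub-balaban audit G-B11-F3).

CONTENT (0 sorry; DATA defs `avgKernelGauges`, `covLapSite`, `covDiff`, `covLapDir`; `Prop`-valued SHAPES `IsLandauB8`, `LandauRepB8`,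
`PairLandauGaugeB8` — predicates with parameters, asserted for nothing; theorems = bookkeeping + the junction):
§1 the operators and B8's test space; §2 `IsLandauB8` ((1.38) variational) with `isLandauB8_zero`; §3 `LandauRepB8` (the per-pair body:
gauge, representation, (1.38), (1.36) sup ∕ gradient ∕ Hölder-β, (1.39) rough Laplacian) and **`PairLandauGaugeB8 d 𝒞 L N b g s₁ s₂ β dom`**
(for every level `k ≥ 1`, datum, minimiser pair with `U_B` `(b,g)`-regular: `∃ (u, Z), LandauRepB8 …` at `W = rescale L (bavg L U_B)`;
`s₁ = B₁(α₀+α₁)`, `s₂ = B₂(β₀)(α₀+α₁)`); §4 bookkeeping (`perPair`, `mono`, the flat NON-VACUITY `pairLandauGaugeB8_flat`, and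
`lip_of_pairLandauGaugeB8`: the (J1)∕(Lip₁ᶜ)∕(Lip₂′ᶜ)-currencies ARE clauses of the shape, the last at `β = 1`);
§5 **THE JUNCTION `ne3EnergyRateWCov_of_pairLandauGaugeB8`**: `NE3EnergyRateWCov d 𝒞 L N b g ((1+θ₀)·(4∕cΛ)·C′) s₁ s₂ dom` ⇐
`PairLandauGaugeB8 d 𝒞 L N b g s₁ s₂ 1 dom` ∧ (per pair, GIVEN the B8 representative `(u, Z)`) `W` unitary and an endpoint chart with gauge `u`
STARTING AT `Z` (`Γ 0 = Z`) on SOME direction set `T` (skew, periodic members) with level data, (P♮) `SlicePoincare L k W T CP …` and (RES♯)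
`CurlPairedResidual L k W T (C′·residualScale …) …` ∧ the k-free numeric lines — over the companion module's slice-generic END.

WHAT THE JUNCTION DISPLAYS AS OPEN (R3's located remaining work, `ne/NE3.md` §4): (i) the CHART SUPPLIER on B8's surface — the product-path
decomposition `Z = N − X` with tangent datum `X ∈ T(W)` and normal sizes (route Π's Π-C∕Π-R rows, re-run for a slice compatible with (1.38): the
owner's `T_♮(W) = frameFreeBlockLandauW` is NOT: tangency to the PLAIN fibre pins the total gauge at the block corners, and `T_♮`'s block-Landau
clause then forces lattice Coulomb spikes of relative height `L^k` there — the corner conditions (1.14) that B8 p. 80 replaces by (1.29) «These conditions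
are very hard to work with analytically»; census R23; v1.0.1 DOCFIX of this sentence, no declaration changed); (ii) (P♮) on that `T(W)` —
printed TYPE [Balaban1985BackgroundPropagators] Thm 3.3 (3.46)–(3.47) pp. 397–398 ∕ [Balaban1984PropagatorsII] (2.153), not in the tree on any B8-compatible
slice; (iii) (RES♯) there (kernel for `T ⊆ TangentIter`, `NE3CurlPairedResidualScale`; a B8-compatible `T` has a coarse gauge component).

HONEST FRAMING.  A typed hypothesis SHAPE discharges nothing: `PairLandauGaugeB8 4 (sfClass 4 L N ε) …` for Bałaban's minimisers is [B8] Thm 2 ∘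
[B11] Thm 1 READ at the pair — the reading (R-a)–(R-f) is ours, the theorems are Bałaban's, and NEITHER is proved here or anywhere in the tree
(pub-balaban audit: B8 Thm 2's existence half certified modulo constants C-B8-10…13, G-B8-02∕03∕11∕12∕14∕17; uniqueness G-B8-05); the junction
is an implication whose chart-supplier, (P♮) and (RES♯) hypotheses are OPEN.  ABSOLUTE RULE kept: no printed sentence is a hypothesis of a
theorem — the shape is a `def`, taken as a hypothesis BY NAME.  The covariant root and **NE3 are NOT proved**; spine PROVED 0∕9; finite T⁴ rung
(B)+1 — NOT infinite volume, NOT mass gap, NOT `BetaPertH`, NOT Clay.  HONEST DEPENDENCY (cell page 1): continuum YM on T⁴ ⇐ BetaPertH ∧ nine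
spine estimates (0/9 proved); BetaPertH ⇐ (D1) ∧ (D4) ∧ CAP+tail; G-an2-4 gates asym, D1 and NE2/3/4.  PLACEMENT:
`Summits/QuantumFields/BalabanUV/T4Continuum/Spine/NE3/` (the cell's «statements first under Spine/»); imports accepted modules only; moves nothing.
-/

set_option autoImplicit false

open scoped BigOperators Matrix Matrix.Norms.L2Operator
open NormedSpace Finset

namespace Summit.QuantumFields.BalabanUV.T4Continuum.NE3.PairLandauB8

open Set
open Literature.MathematicalPhysics.QuantumFieldTheory.Balaban1983to89
open B7Prop1Explicit B7Prop2Explicit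
open T4AveragingDeficitWall hiding Site Plane Plaq Bond
open T4AveragingDeficitWallBoundary (IsPeriodicCfg periodBox)
open AveragingDeficitPeriodicCounting (IsPeriodicDir)
open AveragingDeficitChartCalculus (cavg)
open MinimalActionSandwich (IsMinimiser)
open MinimalActionRate (Regular)
open MinimalActionWitness (flatCfg flatClass)
open NE3EnergyShapes (residualScale residualScale_nonneg IsUnitarySite IsPeriodicSite gaugeAct_one rescale_bavg_flatCfg)
open NE3EnergyWeightedShapes (energyNormW CurlPairedResidual)
open NE3EnergyWeightedCovShape (NE3EnergyRateWCov)
open NE3CovariantCalculus (hsR hsR_comm cD cDstar)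
open NE3LandauOrbit (hsR_zero_left)
open BlockAveragePushDirGauge (gaugeDir)
open NE3CovariantBlockMean (bmeanIterW)
open NE3SlicePoincareShape (SlicePoincare)
open NE3EndpointChart (EndpointChart)
open NE3EnergyRateWSupOfSlicePoincare (cLambda)
open NE3EnergyRateWCovOfEndpointChart (ne3EnergyRateWCov_of_endpointChart_slice)

noncomputable section

variable {d : ℕ} {n : Type*} [Fintype n] [DecidableEq n]

/-! ## §1 The operators of (1.36)∕(1.38)∕(1.39) in the tree's END-framed conventions, and B8's test space `N(Q′(W))` -/

/-- **`N(Q′(W))` IN THE TREE'S READING** (level `k`, period `N·L^k`): the skew, `(N·L^k)`-periodic site fields `μ` whose NESTED TRANSPORTED BLOCK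
MEAN through the `k`-fold averaging tower at `W` vanishes, `bmeanIterW L k W μ = 0` — the linearisation at `u = 1` of B8's restriction (1.29)
«(R₀ū)ʲ(y) = 1» in the all-small-field case (`j = k` only), by p. 80 «a linear part of (1/i) log(R₀u_j)(y) is equal to (Q′_j(U₀)λ)(y)» and K0a's
curved identity (‡) `framePotW L k W (gaugeDir W μ) z = μ (L^k•z) − bmeanIterW L k W μ z`.  Reading (R-d); a DATA definition. [folklore] -/
def avgKernelGauges (L N k : ℕ) (W : Site d → Fin d → (Matrix n n ℂ)ˣ) : Set (Site d → Matrix n n ℂ) :=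
  {μ | (∀ y : Site d, μ y ∈ skewAdjoint (Matrix n n ℂ)) ∧
    (∀ (y : Site d) (i : Fin d), μ (y + ((N * L ^ k : ℕ) : ℤ) • e i) = μ y) ∧
    bmeanIterW L k W μ = 0}

/-- Membership in `N(Q′(W))`, unfolded. [folklore] -/
theorem mem_avgKernelGauges_iff {L N k : ℕ} {W : Site d → Fin d → (Matrix n n ℂ)ˣ} {μ : Site d → Matrix n n ℂ} :
    μ ∈ avgKernelGauges (d := d) (n := n) L N k W ↔
      (∀ y : Site d, μ y ∈ skewAdjoint (Matrix n n ℂ)) ∧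
      (∀ (y : Site d) (i : Fin d), μ (y + ((N * L ^ k : ℕ) : ℤ) • e i) = μ y) ∧ bmeanIterW L k W μ = 0 :=
  Iff.rfl

/-- **THE COVARIANT SITE LAPLACIAN** `Δ_W μ := Σ_ν D*_ν D_ν μ` of a site-framed `𝔤`-valued function at the background `W`, over the tree's covariant
forward difference `NE3CovariantCalculus.cD` and its formal `hsR`-adjoint `cDstar` ([Balaban1985BackgroundPropagators] (3.23) «Δ^η_U = D^{η*}_U D^η_U»
TYPE, unit lattice, no `η`-factors).  A DATA definition. [folklore] -/
def covLapSite (W : Site d → Fin d → (Matrix n n ℂ)ˣ) (μ : Site d → Matrix n n ℂ) : Site d → Matrix n n ℂ :=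
  fun y => ∑ ν : Fin d, cDstar W ν (cD W ν μ) y

/-- **THE COVARIANT FORWARD DIFFERENCE OF AN END-FRAMED BOND FIELD** along `e_μ`: `(∇_μ Z)(x, κ) = Ad_{W(x+e_κ, μ)} Z(x+e_μ, κ) − Z(x, κ)`
(`Z(x, κ)` sits at the frame of `x + e_κ` under `vary W Z 1 = W·e^{Z}`; the value on the parallel bond is transported back along `(x+e_κ; μ)`) —
the expression INTERFACE REQUEST NE7→NE3 amendment 4 calls (Lip₁ᶜ); [Balaban1985RegularSpaces] (1.1) «(D^η_{U,μ}F)(x) = η⁻¹(R(U(x,x+ηe_μ))F(x+ηe_μ)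
− F(x))» TYPE without the `η⁻¹`.  A DATA definition. [folklore] -/
def covDiff (W : Site d → Fin d → (Matrix n n ℂ)ˣ) (μ : Fin d) (Z : Site d → Fin d → Matrix n n ℂ) :
    Site d → Fin d → Matrix n n ℂ :=
  fun x κ => Ad (W (x + e κ) μ) (Z (x + e μ) κ) - Z x κ

/-- **THE ROUGH COVARIANT LAPLACIAN `D*D` OF AN END-FRAMED BOND FIELD**: `Σ_μ [(∇_μ Z)(x, κ) − Ad_{W(x+e_κ−e_μ, μ)}⁻¹ (∇_μ Z)(x−e_μ, κ)]` (forward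
difference minus the backward-transported forward difference, summed over directions) — the `D^{η*}_{U₀}D^η_{U₀}A` member of
[Balaban1985RegularSpaces] (1.39), up to sign and the factor `η⁻²` (reading (R-e)).  A DATA definition. [folklore] -/
def covLapDir (W : Site d → Fin d → (Matrix n n ℂ)ˣ) (Z : Site d → Fin d → Matrix n n ℂ) : Site d → Fin d → Matrix n n ℂ :=
  fun x κ => ∑ μ : Fin d, (covDiff W μ Z x κ - Ad (W (x + e κ - e μ) μ)⁻¹ (covDiff W μ Z (x - e μ) κ))

/-- The covariant difference of the zero field vanishes. [folklore] -/
@[simp] theorem covDiff_zero (W : Site d → Fin d → (Matrix n n ℂ)ˣ) (μ : Fin d) :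
    covDiff W μ (fun (_ : Site d) (_ : Fin d) => (0 : Matrix n n ℂ)) = fun _ _ => 0 := by
  funext x κ
  simp [covDiff, Ad]

/-- The rough Laplacian of the zero field vanishes. [folklore] -/
@[simp] theorem covLapDir_zero (W : Site d → Fin d → (Matrix n n ℂ)ˣ) :
    covLapDir W (fun (_ : Site d) (_ : Fin d) => (0 : Matrix n n ℂ)) = fun _ _ => 0 := by
  funext x κ
  simp [covLapDir, Ad]

/-! ## §2 (1.38) in variational form: the Landau gauge RELATIVE TO `W` against the test space `Δ_W N(Q′(W))` -/

/-- **(1.38) «R(U₀)D^{η*}_{U₀}A = 0» IN VARIATIONAL FORM, IN THE TREE'S VOCABULARY** (level `k`, period `N·L^k`, background `W`, END-framed direction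
`Z`): for every `μ ∈ N(Q′(W))` (`avgKernelGauges`), `Σ_{x ∈ periodBox (N·L^k)} Σ_κ hsR (Z x κ) (gaugeDir W (Δ_W μ) x κ) = 0` — `Z` is `hsR`-orthogonal
over one period to the gauge directions generated by `Δ_W N(Q′(W))`.  Since `R(U₀)` is the orthogonal projection ONTO `Δ^η_{U₀}N(Q′(U₀))` (p. 80),
«R(U₀)X = 0» ⟺ «X ⊥ Δ N(Q′)» (cf. `B8Eq127LandauGauge.isLandauBG_iff_mem_orthogonal` on abstract carriers), and «D*A ⊥ Δμ» ⟺ «A ⊥ D(Δμ)» by the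
periodic summation by parts (`NE3CovariantCalculus.sum_hsR_cD`; `gaugeDir W f = −Ad⁻¹∘cD W f` bondwise), insensitive to the sign and scale
conventions of (R-c)∕(R-d).  A hypothesis SHAPE, asserted for nothing. [folklore] -/
@[folklore]
def IsLandauB8 (L N k : ℕ) (W : Site d → Fin d → (Matrix n n ℂ)ˣ) (Z : Site d → Fin d → Matrix n n ℂ) : Prop :=
  ∀ μ ∈ avgKernelGauges (d := d) (n := n) L N k W,
    ∑ x ∈ periodBox (d := d) (N * L ^ k), ∑ κ : Fin d, hsR (Z x κ) (gaugeDir W (covLapSite W μ) x κ) = 0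

/-- The zero direction is in the Landau gauge relative to every background (`U₁ = U₀`: the background is its own Landau representative;
cf. `B8Eq127LandauGauge.isLandauBG_zero`). [folklore] -/
theorem isLandauB8_zero (L N k : ℕ) (W : Site d → Fin d → (Matrix n n ℂ)ˣ) :
    IsLandauB8 (d := d) L N k W (fun (_ : Site d) (_ : Fin d) => (0 : Matrix n n ℂ)) := by
  intro μ _
  exact Finset.sum_eq_zero fun x _ => Finset.sum_eq_zero fun κ _ => hsR_zero_left _

/-! ## §3 The shape: B8's Landau representative of the run-A minimiser relative to the averaged run-B minimiser -/

/-- **THE B8 LANDAU REPRESENTATIVE OF A PAIR AT LEVEL `k`** (background `W`, configuration `U_A`, period `N·L^k`, `ξ := (L⁻¹)^k`): a unitary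
periodic site gauge `u` and a skew periodic END-framed direction `Z` with `U_A^u = W·e^{Z}` such that — [Balaban1985RegularSpaces] Thm 2's
conclusions READ at `j = k` per (R-a)–(R-f) — (1.38) `IsLandauB8 L N k W Z`; (1.36) `‖Z(b)‖ ≤ s₁·ξ`, first covariant differences `≤ s₁·ξ²`, nearest-
neighbour Hölder-`β` second covariant differences `≤ s₂·ξ^{2+β}`; (1.39) rough covariant Laplacian `≤ s₁·ξ³` (`s₁ = B₁(α₀+α₁)`, `s₂ = B₂(β₀)(α₀+α₁)`).
The restriction (1.29) on `u` is NOT a field: the endpoint-chart consumer accepts any unitary periodic `u` (companion module).  A hypothesis SHAPE,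
asserted for nothing. [folklore] -/
@[folklore]
structure LandauRepB8 (L N k : ℕ) (W UA : Site d → Fin d → (Matrix n n ℂ)ˣ) (u : Site d → (Matrix n n ℂ)ˣ)
    (Z : Site d → Fin d → Matrix n n ℂ) (s₁ s₂ β : ℝ) : Prop where
  /-- the gauge transformation is `U(N)`-valued -/
  unitary : IsUnitarySite u
  /-- the gauge transformation is `(N·L^k)`-periodic -/
  periodic : IsPeriodicSite u ((N * L ^ k : ℕ) : ℤ)
  /-- the direction is `𝔲(N)`-valued -/
  skew : IsSkewDir Z
  /-- the direction is `(N·L^k)`-periodic -/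
  per : IsPeriodicDir Z ((N * L ^ k : ℕ) : ℤ)
  /-- the representation `U_A^u = W·e^{Z}` («U₁ = U′^{u⁻¹} = e^{iηA}U₀», reading (R-c)) -/
  rep : gaugeAct u UA = vary W Z 1
  /-- (1.38) the Landau gauge relative to `W`, variational form -/
  landau : IsLandauB8 L N k W Z
  /-- (1.36), first clause at `j = k`: `∣A∣ < B₁(α₀+α₁)(Lᵏη)⁻¹`, i.e. `‖Z(b)‖ ≤ s₁·ξ` -/
  sup : ∀ (x : Site d) (κ : Fin d), ‖Z x κ‖ ≤ s₁ * ((L : ℝ)⁻¹) ^ k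
  /-- (1.36), second clause at `j = k`: `∣∇^η_{U₀}A∣ < B₁(α₀+α₁)(Lᵏη)⁻²`, i.e. first covariant differences `≤ s₁·ξ²` ((Lip₁ᶜ)'s expression) -/
  grad : ∀ (κ : Fin d) (x : Site d) (μ : Fin d),
    ‖Ad (W (x + e κ) μ) (Z (x + e μ) κ) - Z x κ‖ ≤ s₁ * (((L : ℝ)⁻¹) ^ k) ^ 2
  /-- (1.36), third clause at `j = k` and nearest-neighbour distance: `‖A‖_{1,β} ≤ B₂(β₀)(α₀+α₁)(Lᵏη)^{−2−β}` gives second covariant differences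
  `≤ s₂·ξ^{2+β}` ((Lip₂′ᶜ)'s expression at the printed level; reading (R-f)) -/
  holder : ∀ (κ μ : Fin d) (y : Site d),
    ‖Ad (W (y + e κ) μ) (Ad (W (y + e κ + e μ) μ) (Z (y + (2 : ℕ) • e μ) κ) - Z (y + e μ) κ)
      - (Ad (W (y + e κ) μ) (Z (y + e μ) κ) - Z y κ)‖ ≤ s₂ * (((L : ℝ)⁻¹) ^ k) ^ ((2 : ℝ) + β)
  /-- (1.39), the `D^{η*}_{U₀}D^η_{U₀}A` member at `j = k`: rough covariant Laplacian `≤ s₁·ξ³` (reading (R-e)) -/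
  lap : ∀ (x : Site d) (κ : Fin d), ‖covLapDir W Z x κ‖ ≤ s₁ * (((L : ℝ)⁻¹) ^ k) ^ 3

variable (d) in
/-- **`PairLandauGaugeB8` — [Balaban1985RegularSpaces] THEOREM 2 READ AT THE MINIMISER PAIR** (a `Prop`; asserted for no class here except the flat
one below).  For every level `k ≥ 1`, datum `V ∈ dom`, minimiser `U_A` of the `k`-step run and `(b, g)`-regular minimiser `U_B` of the `(k+1)`-step
run (the quantifier prefix of `NE3EnergyRateWCov`, token for token) there are `(u, Z)` with `LandauRepB8 L N k W U_A u Z s₁ s₂ β` at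
`W := rescale L (bavg L U_B)`.  The printed hypotheses (1.33)∕(1.34) of Thm 2 (regularity of `W` and of `U_A`, axial pre-gauge `Ax_k(𝔅_k, W)`) are
the [Balaban1985Variational] Thm 1 (8)–(10) TYPE for the two runs plus kernel transport (`MinimalActionRate.rescale_bavg_mem_sfClass`,
`B8Eq115GaugeFixing`∕`B8Eq119TwistedAxial`); (1.35) is free at the pair (reading (R-b)).  So this shape is «[B8] Thm 2 ∘ [B11] Thm 1 at the pair» in
the tree's words — a printed-TYPE hypothesis under the reading (R-a)–(R-f), NOT a printed sentence and NOT proved. [folklore] -/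
@[folklore]
def PairLandauGaugeB8 (𝒞 : ℕ → Set (Site d → Fin d → (Matrix n n ℂ)ˣ)) (L N : ℕ) (b g s₁ s₂ β : ℝ)
    (dom : Set (Site d → Fin d → (Matrix n n ℂ)ˣ)) : Prop :=
  ∀ k : ℕ, 1 ≤ k → ∀ V ∈ dom, ∀ UA UB : Site d → Fin d → (Matrix n n ℂ)ˣ,
    IsMinimiser d 𝒞 L N k V UA → IsMinimiser d 𝒞 L N (k + 1) V UB → Regular d L N b g (k + 1) UB →
      ∃ (u : Site d → (Matrix n n ℂ)ˣ) (Z : Site d → Fin d → Matrix n n ℂ),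
        LandauRepB8 L N k (rescale L (bavg L UB)) UA u Z s₁ s₂ β

/-! ## §4 Bookkeeping: the per-pair body, monotonicity, non-vacuity, the currencies it carries -/

/-- The shape applied at one level ∕ datum ∕ pair. [folklore] -/
theorem PairLandauGaugeB8.perPair {𝒞 : ℕ → Set (Site d → Fin d → (Matrix n n ℂ)ˣ)} {L N : ℕ} {b g s₁ s₂ β : ℝ}
    {dom : Set (Site d → Fin d → (Matrix n n ℂ)ˣ)} (h : PairLandauGaugeB8 d 𝒞 L N b g s₁ s₂ β dom)
    {k : ℕ} (hk : 1 ≤ k) {V : Site d → Fin d → (Matrix n n ℂ)ˣ} (hV : V ∈ dom) {UA UB : Site d → Fin d → (Matrix n n ℂ)ˣ}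
    (hA : IsMinimiser d 𝒞 L N k V UA) (hB : IsMinimiser d 𝒞 L N (k + 1) V UB) (hreg : Regular d L N b g (k + 1) UB) :
    ∃ (u : Site d → (Matrix n n ℂ)ˣ) (Z : Site d → Fin d → Matrix n n ℂ), LandauRepB8 L N k (rescale L (bavg L UB)) UA u Z s₁ s₂ β :=
  h k hk V hV UA UB hA hB hreg

/-- The per-pair body is monotone in the two constants `s₁ ≤ s₁′`, `s₂ ≤ s₂′` (`ξ = (L⁻¹)^k ≥ 0` for a natural `L`). [folklore] -/
theorem LandauRepB8.mono {L N k : ℕ} {W UA : Site d → Fin d → (Matrix n n ℂ)ˣ} {u : Site d → (Matrix n n ℂ)ˣ}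
    {Z : Site d → Fin d → Matrix n n ℂ} {s₁ s₁' s₂ s₂' β : ℝ} (h : LandauRepB8 L N k W UA u Z s₁ s₂ β) (h₁ : s₁ ≤ s₁')
    (h₂ : s₂ ≤ s₂') : LandauRepB8 L N k W UA u Z s₁' s₂' β := by
  have hξ : 0 ≤ ((L : ℝ)⁻¹) ^ k := pow_nonneg (inv_nonneg.mpr (Nat.cast_nonneg L)) k
  exact
    { unitary := h.unitary
      periodic := h.periodic
      skew := h.skew
      per := h.per
      rep := h.rep
      landau := h.landau
      sup := fun x κ => (h.sup x κ).trans (mul_le_mul_of_nonneg_right h₁ hξ)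
      grad := fun κ x μ => (h.grad κ x μ).trans (mul_le_mul_of_nonneg_right h₁ (pow_nonneg hξ 2))
      holder := fun κ μ y => (h.holder κ μ y).trans (mul_le_mul_of_nonneg_right h₂ (Real.rpow_nonneg hξ _))
      lap := fun x κ => (h.lap x κ).trans (mul_le_mul_of_nonneg_right h₁ (pow_nonneg hξ 3)) }

/-- `PairLandauGaugeB8` is monotone in `s₁`, `s₂`. [folklore] -/
theorem PairLandauGaugeB8.mono {𝒞 : ℕ → Set (Site d → Fin d → (Matrix n n ℂ)ˣ)} {L N : ℕ} {b g s₁ s₁' s₂ s₂' β : ℝ}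
    {dom : Set (Site d → Fin d → (Matrix n n ℂ)ˣ)} (h : PairLandauGaugeB8 d 𝒞 L N b g s₁ s₂ β dom) (h₁ : s₁ ≤ s₁')
    (h₂ : s₂ ≤ s₂') : PairLandauGaugeB8 d 𝒞 L N b g s₁' s₂' β dom := by
  intro k hk V hV UA UB hA hB hreg
  obtain ⟨u, Z, hZ⟩ := h k hk V hV UA UB hA hB hreg
  exact ⟨u, Z, hZ.mono h₁ h₂⟩

/-- **NON-VACUITY**: in the flat class with the flat datum the shape holds for every `s₁, s₂ ≥ 0` and every exponent `β` (both minimisers flat,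
`u = 1`, `Z = 0`; the zero direction is Landau relative to the flat background, `isLandauB8_zero`). [folklore] -/
theorem pairLandauGaugeB8_flat [Nonempty n] (L N : ℕ) (b g β : ℝ) {s₁ s₂ : ℝ} (hs₁ : 0 ≤ s₁) (hs₂ : 0 ≤ s₂) :
    PairLandauGaugeB8 d (flatClass (n := n)) L N b g s₁ s₂ β {flatCfg} := by
  intro k _ V _ UA UB hA hB _
  have hUA : UA = flatCfg := by simpa [flatClass, MinimalActionSandwich.admissible] using hA.mem.1
  have hUB : UB = flatCfg := by simpa [flatClass, MinimalActionSandwich.admissible] using hB.mem.1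
  have hξ : 0 ≤ ((L : ℝ)⁻¹) ^ k := pow_nonneg (inv_nonneg.mpr (Nat.cast_nonneg L)) k
  refine ⟨fun _ => 1, fun (_ : Site d) (_ : Fin d) => (0 : Matrix n n ℂ), ?_⟩
  exact
    { unitary := fun _ => (unitaryUnits _).one_mem
      periodic := fun _ _ => rfl
      skew := fun _ _ => (skewAdjoint _).zero_mem
      per := fun _ _ _ => rfl
      rep := by rw [hUA, hUB, rescale_bavg_flatCfg, gaugeAct_one, vary_zero_dir]
      landau := isLandauB8_zero L N k _
      sup := fun x κ => by rw [norm_zero]; exact mul_nonneg hs₁ hξ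
      grad := fun κ x μ => by
        simp only [Ad, mul_zero, zero_mul, sub_zero, norm_zero]
        exact mul_nonneg hs₁ (pow_nonneg hξ 2)
      holder := fun κ μ y => by
        simp only [Ad, mul_zero, zero_mul, sub_zero, norm_zero]
        exact mul_nonneg hs₂ (Real.rpow_nonneg hξ _)
      lap := fun x κ => by
        rw [covLapDir_zero]
        simp only [norm_zero]
        exact mul_nonneg hs₁ (pow_nonneg hξ 3) }

/-- `ξ^{2+1} = ξ³` (real exponent versus natural exponent). [folklore] -/
theorem rpow_two_add_one (x : ℝ) : x ^ ((2 : ℝ) + 1) = x ^ 3 := by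
  rw [show ((2 : ℝ) + 1) = ((3 : ℕ) : ℝ) by norm_num, Real.rpow_natCast]

/-- **THE CURRENCIES THE SHAPE CARRIES, BY NAME** (`β = 1`): per pair, the B8 representative `(u, Z)` has the representation of the covariant root
at `W = rescale L (bavg L U_B)`, the DECAYING SUP BOUND `‖Z(b)‖ ≤ s₁·(L⁻¹)^k` (route Π's located currency (J1), `NE3EnergyWeightedSupShape`'s sup
conjunct), (Lip₁ᶜ) with `Λ₁ = s₁` and (Lip₂′ᶜ) with `Λ₂′ = s₂` VERBATIM as `NE3EnergyRateWCov` words them — everything of the covariant root except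
the ENERGY conjunct, which is NE3 proper and not printed. [folklore] -/
theorem lip_of_pairLandauGaugeB8 {𝒞 : ℕ → Set (Site d → Fin d → (Matrix n n ℂ)ˣ)} {L N : ℕ} {b g s₁ s₂ : ℝ}
    {dom : Set (Site d → Fin d → (Matrix n n ℂ)ˣ)} (h : PairLandauGaugeB8 d 𝒞 L N b g s₁ s₂ 1 dom)
    {k : ℕ} (hk : 1 ≤ k) {V : Site d → Fin d → (Matrix n n ℂ)ˣ} (hV : V ∈ dom) {UA UB : Site d → Fin d → (Matrix n n ℂ)ˣ}
    (hA : IsMinimiser d 𝒞 L N k V UA) (hB : IsMinimiser d 𝒞 L N (k + 1) V UB) (hreg : Regular d L N b g (k + 1) UB) :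
    ∃ (u : Site d → (Matrix n n ℂ)ˣ) (Z : Site d → Fin d → Matrix n n ℂ),
      IsUnitarySite u ∧ IsPeriodicSite u ((N * L ^ k : ℕ) : ℤ) ∧ IsSkewDir Z ∧ IsPeriodicDir Z ((N * L ^ k : ℕ) : ℤ) ∧
      gaugeAct u UA = vary (rescale L (bavg L UB)) Z 1 ∧
      IsLandauB8 L N k (rescale L (bavg L UB)) Z ∧
      (∀ (x : Site d) (κ : Fin d), ‖Z x κ‖ ≤ s₁ * ((L : ℝ)⁻¹) ^ k) ∧
      (∀ (κ : Fin d) (x : Site d) (μ : Fin d),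
        ‖Ad (rescale L (bavg L UB) (x + e κ) μ) (Z (x + e μ) κ) - Z x κ‖ ≤ s₁ * (((L : ℝ)⁻¹) ^ k) ^ 2) ∧
      (∀ (κ μ : Fin d) (y : Site d),
        ‖Ad (rescale L (bavg L UB) (y + e κ) μ)
            (Ad (rescale L (bavg L UB) (y + e κ + e μ) μ) (Z (y + (2 : ℕ) • e μ) κ) - Z (y + e μ) κ)
          - (Ad (rescale L (bavg L UB) (y + e κ) μ) (Z (y + e μ) κ) - Z y κ)‖ ≤ s₂ * (((L : ℝ)⁻¹) ^ k) ^ 3) := by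
  obtain ⟨u, Z, hZ⟩ := h k hk V hV UA UB hA hB hreg
  refine ⟨u, Z, hZ.unitary, hZ.periodic, hZ.skew, hZ.per, hZ.rep, hZ.landau, hZ.sup, hZ.grad, fun κ μ y => ?_⟩
  have h2 := hZ.holder κ μ y
  rwa [rpow_two_add_one] at h2

/-! ## §5 THE JUNCTION: the covariant root from `PairLandauGaugeB8` and a per-pair endpoint chart starting at the B8 representative -/

/-- **THE JUNCTION OF R3 — `NE3EnergyRateWCov` ⇐ `PairLandauGaugeB8` ∧ (per pair) AN ENDPOINT CHART STARTING AT THE B8 REPRESENTATIVE ON A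
DIRECTION SET CARRYING (P♮) AND (RES♯) ∧ k-FREE NUMERIC LINES** (class-generic; `d ≥ 1`, `L, N ≥ 1`; `β = 1`, see (R-f)).  HYPOTHESES: `hB8 :
PairLandauGaugeB8 d 𝒞 L N b g s₁ s₂ 1 dom`; `hchart`: for every level `k ≥ 1`, datum `V ∈ dom`, minimiser pair `(U_A, U_B)` with `U_B` `(b,g)`-regular
AND EVERY B8 representative `(u, Z)` of the pair (`LandauRepB8 L N k W U_A u Z s₁ s₂ 1`, `W = cavg L U_B`): `W` is unitary and there are a direction
set `T` (skew, `(N·L^k)`-periodic members), an endpoint chart `EndpointChart 𝒞 L N k V U_A U_B u Γ Ψ Ψ′ Xref T (energyNormW L k W · (periodBox (N·L^k)))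
θ κ θ₀ q a` WITH GAUGE `u` AND START `Γ 0 = Z`, level data `(α, a)` (sup-radius `α` of the path, `(1 + 24√d(e^α−1)L^k)² + 48·d·a·(L^k)² ≤ Λ`,
`112·d·a·CP·(L^k)² ≤ 1∕(2·card n)`), (P♮) `SlicePoincare L k W T CP (periodBox (N·L^k))` and (RES♯) `CurlPairedResidual L k W T (C′·residualScale d L N b g k)
(periodBox (N·L^k))`; uniformly `0 ≤ CP`, `CP·(√Λ−1)² ≤ 1∕4`, `0 ≤ θ₀`, `0 ≤ C′`, budget `2Λθ + Λθ² + κ + 2q ≤ cΛ∕2`.  CONCLUSION: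
**`NE3EnergyRateWCov d 𝒞 L N b g ((1+θ₀)·(4∕cΛ)·C′) s₁ s₂ dom`** — the energy conjunct from the chart (companion module's slice-generic END), the
representation, (Lip₁ᶜ) and (Lip₂′ᶜ) from the B8 representative itself.  What stays OPEN is displayed: the chart supplier on a B8-compatible
slice, (P♮) there ([Balaban1985BackgroundPropagators] Thm 3.3 TYPE) and (RES♯) there. [folklore] -/
theorem ne3EnergyRateWCov_of_pairLandauGaugeB8 [Nonempty n] (hd : 1 ≤ d) {𝒞 : ℕ → Set (Site d → Fin d → (Matrix n n ℂ)ˣ)}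
    {L N : ℕ} (hL : 1 ≤ L) (hN : 1 ≤ N) {b g s₁ s₂ : ℝ} {dom : Set (Site d → Fin d → (Matrix n n ℂ)ˣ)}
    {CP Λ θ κ θ₀ q C' : ℝ} (hCP : 0 ≤ CP) (hreg₁ : CP * (Real.sqrt Λ - 1) ^ 2 ≤ 1 / 4) (hθ₀ : 0 ≤ θ₀) (hC' : 0 ≤ C')
    (hbudget : 2 * Λ * θ + Λ * θ ^ 2 + κ + 2 * q ≤ cLambda n CP Λ / 2)
    (hB8 : PairLandauGaugeB8 d 𝒞 L N b g s₁ s₂ 1 dom)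
    (hchart : ∀ k : ℕ, 1 ≤ k → ∀ V ∈ dom, ∀ UA UB : Site d → Fin d → (Matrix n n ℂ)ˣ,
      IsMinimiser d 𝒞 L N k V UA → IsMinimiser d 𝒞 L N (k + 1) V UB → Regular d L N b g (k + 1) UB →
      ∀ (u : Site d → (Matrix n n ℂ)ˣ) (Z : Site d → Fin d → Matrix n n ℂ), LandauRepB8 L N k (cavg L UB) UA u Z s₁ s₂ 1 →
        IsUnitaryCfg (cavg L UB) ∧
        ∃ (T : Set (Site d → Fin d → Matrix n n ℂ)) (Γ Ψ Ψ' : ℝ → Site d → Fin d → Matrix n n ℂ)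
          (Xref : Site d → Fin d → Matrix n n ℂ) (α a : ℝ),
          (∀ Y ∈ T, IsSkewDir Y) ∧ (∀ Y ∈ T, IsPeriodicDir Y ((N * L ^ k : ℕ) : ℤ)) ∧ 0 ≤ α ∧ 0 ≤ a ∧ Γ 0 = Z ∧
          EndpointChart 𝒞 L N k V UA UB u Γ Ψ Ψ' Xref T
            (fun Y => energyNormW L k (cavg L UB) Y (periodBox (N * L ^ k))) θ κ θ₀ q a ∧
          (∀ t (x : Site d) (μ : Fin d), ‖Γ t x μ‖ ≤ α) ∧
          (1 + 24 * Real.sqrt d * (Real.exp α - 1) * (L : ℝ) ^ k) ^ 2 + 48 * d * a * ((L : ℝ) ^ k) ^ 2 ≤ Λ ∧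
          112 * (d : ℝ) * a * CP * ((L : ℝ) ^ k) ^ 2 ≤ 1 / (2 * (Fintype.card n : ℝ)) ∧
          SlicePoincare L k (cavg L UB) T CP (periodBox (N * L ^ k)) ∧
          CurlPairedResidual L k (cavg L UB) T (C' * residualScale d L N b g k) (periodBox (N * L ^ k))) :
    NE3EnergyRateWCov d 𝒞 L N b g ((1 + θ₀) * (4 / cLambda n CP Λ) * C') s₁ s₂ dom := by
  refine ne3EnergyRateWCov_of_endpointChart_slice hd hL hN hCP hreg₁ hθ₀ hC' hbudget ?_
  intro k hk V hV UA UB hA hB hreg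
  obtain ⟨u, Z, hZ⟩ := hB8 k hk V hV UA UB hA hB hreg
  obtain ⟨hW, T, Γ, Ψ, Ψ', Xref, α, a, hskewT, hperT, hα, ha, hΓ0, hpath, hΓα, hΛw, hreg₂, hP, hres⟩ :=
    hchart k hk V hV UA UB hA hB hreg u Z hZ
  refine ⟨hW, T, u, Γ, Ψ, Ψ', Xref, α, a, hskewT, hperT, hα, ha, hpath, hΓα, hΛw, hreg₂, hP, hres, ?_, ?_⟩
  · intro κ x μ
    rw [hΓ0]
    exact hZ.grad κ x μ
  · intro κ μ y
    rw [hΓ0]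
    have h2 := hZ.holder κ μ y
    rwa [rpow_two_add_one] at h2

end

end Summit.QuantumFields.BalabanUV.T4Continuum.NE3.PairLandauB8
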